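import Literature.NumberTheory.Transcendental.UnivExtThetaPoints
import Literature.NumberTheory.Transcendental.SemistableQuotients
import HarnessLib

/-!
# The theta model of the group varieties `M_κ = 𝔾ₘ^β × P_κ`

Topic: `Literature/NumberTheory/Transcendental`. Third brick (W2c in the plan of the unit
`provefact-Literature.NumberTheory.Transcendental.H-b596640137`, fact
`Literature.NumberTheory.Transcendental.HuberWustholzOnePeriods`) of the theta model on which
Baker–Wüstholz's Semistability Theorem for the explicit groups `M_κ` of
`SemistableQuotients.lean` (`semistabilityTheorem_std_tors`, `SemistableTorsion.lean`) is to be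
proved by Baker's method, and in whose terms the multiplicity estimate (Baker–Wüstholz 2007,
Thm. 6.14) will be vendored.

Recall (`SemistableQuotients.lean`): `Lie M_κ,ℂ = ℂ^β × ℂ^γ × ℂ^δ` with coordinates
`(y'_j; z'_b; s_e)` (`GaGmE.Std.iy/iz/is`), `P_κ` = push-out of the universal vectorial extension
of `E^γ` along `κ : ℚ̄^γ → ℚ̄^δ`, exponential `(e^{y'_j}; ℘(z'_b), ℘′(z'_b); ν_e)` with
`ν_e = s_e - ∑_b κ_{eb} ζ(z'_b)`, kernel `GaGmE.Std.ker`, algebraic points `GaGmE.Std.Alg`.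

## The projective embedding

`M_κ` is embedded in ONE projective space by the Segre product of
`𝔾ₘ^β ⊂ ℙ^β`, `y ↦ (1 : e^{y_1} : ⋯ : e^{y_β})` (coordinates `thetaT a`, `a : Option β`), with the
embedding of `P_κ` by the complete linear system `|∑_b 3·F_{0,b} + D_∞|` of its compactification
`P̄_κ = P_κ ×^{𝔾ₐ^δ} ℙ^δ` (fibres `𝔾ₐ^δ ⊂ ℙ^δ`; `F_{0,b}` = divisor `z'_b ∈ Λ`): its sections
are the functions `Q(℘_b, ℘′_b, ν_e)` of `ν`-degree `≤ 1` with `∏_b σ(z_b)³ · Q` entire, and a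
basis is indexed by `GaGmE.Std.ThetaIdx γ δ = (γ → Fin 3) × Option δ`:

* `Θ^P_{(M, none)} = ∏_b P_{M b}(z_b)` (`= ∏_b σ_b³ · ∏_b (1, ℘_b, ℘′_b)_{M b}`),
* `Θ^P_{(M, some e)} = s_e ∏_b P_{M b}(z_b) - ∑_b κ_{eb} Z_{M b}(z_b) ∏_{b' ≠ b} P_{M b'}(z_{b'})`
  (`= ∏_b σ_b³ · (∏_b (…)_{M b}) · ν_e`, corrected by `+ 2κ_{eb}℘_b²`-terms exactly when
  `M b = 2`, cf. `UnivExtTheta.lean`: `Z₂ = σ³(℘′ζ + 2℘²)`),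

with the blocks `P_i, Z_i` of `UnivExtTheta.lean` (`GaGmE.Std.thetaP`). The theta functions of
`M_κ` are the products `Θ_{(a, I)}(w) = thetaT a (y) · Θ^P_I(z, s)` (`GaGmE.Std.theta`), entire
functions on `Lie M_κ,ℂ`; off the divisors they are `∏_b σ_b³` times monomials in the affine
coordinates `e^{y_j}, ℘_b, ℘′_b, ν_e` of `exp_{M_κ}(w)` (`thetaP_none_eq`, `thetaP_some_eq`).

## What is proved here

* `differentiable_theta` — the theta functions are entire;
* `thetaP_none_eq`, `thetaP_some_eq` — their values off the divisors (as above);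
* `exists_theta_add_ker` — **automorphy under `ker(exp_{M_κ})`**: for `k ∈ GaGmE.Std.ker L κM`,
  `Θ_J(w + k) = c · Θ_J(w)` for all `J` with one `c ≠ 0` (so `[Θ]` is defined on `M_κ(ℂ)`); the
  `s`-shift `∑_b κ_{eb} η(λ_b)` of the kernel is exactly what the `ζ`-companions absorb;
* `exists_theta_ne_zero` — **no common zeros** (base-point freeness on `M_κ`).

Growth and the `ℚ̄`-rationality of `[Θ(w)]` at points of `GaGmE.Std.Alg` follow in the sequel.

## References

* A. Baker, G. Wüstholz, *Logarithmic Forms and Diophantine Geometry*, CUP 2007, §6.7 (group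
  variety embedded in `ℙ^N`), §6.8 (the functions `f_i`), §6.9 (compactifications and
  projective embeddings of commutative group varieties, after Faltings–Wüstholz and Knop–Lange).
* A. Huber, G. Wüstholz, *Transcendence and Linear Relations of 1-Periods*, CUP 2022, Prop. 4.18,
  Def. 4.19, Prop. 4.20 (vector extensions as push-outs).
-/

noncomputable section

open Complex
open scoped PeriodPair

namespace Literature.NumberTheory.Transcendental

namespace GaGmE

namespace Std

variable {β γ δ : Type} [Fintype β] [Fintype γ] [Fintype δ] [DecidableEq γ]
variable (L : PeriodPair) (κM : δ → γ → Kbar)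

/-! ### The theta functions -/

/-- Index set of the theta functions of `P_κ`: a block index `M b ∈ Fin 3` for every `E`-factor
and an optional fibre coordinate `e`. [folklore] -/
abbrev ThetaIdx (γ δ : Type) : Type := (γ → Fin 3) × Option δ

/-- The uncorrected products `∏_b P_{M b}(z'_b)` (`= ∏_b σ_b³ · ∏_b (1, ℘, ℘′)_{M b}` off the
divisors). [folklore] -/
def thetaPnone (M : γ → Fin 3) (w : β ⊕ (γ ⊕ δ) → ℂ) : ℂ :=
  ∏ b, L.univExtP (M b) (w (iz b))

/-- The fibre sections
`s_e ∏_b P_{M b}(z'_b) - ∑_b κ_{eb} Z_{M b}(z'_b) ∏_{b' ≠ b} P_{M b'}(z'_{b'})`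
(`= ∏_b σ_b³ · ∏_b (…)_{M b} · ν_e` up to the corrections making it entire). [folklore] -/
def thetaPsome (M : γ → Fin 3) (e : δ) (w : β ⊕ (γ ⊕ δ) → ℂ) : ℂ :=
  w (is e) * thetaPnone L M w -
    ∑ b, (κM e b : ℂ) * (L.univExtZ (M b) (w (iz b)) *
      ∏ b' ∈ Finset.univ.erase b, L.univExtP (M b') (w (iz b')))

/-- **The theta functions of `P_κ`** on `Lie P_κ,ℂ` (coordinates `z'_b, s_e` of
`Lie M_κ,ℂ`), a basis of the linear system `|∑_b 3F_{0,b} + D_∞|` (module docstring). [folklore] -/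
def thetaP : ThetaIdx γ δ → (β ⊕ (γ ⊕ δ) → ℂ) → ℂ
  | (M, none) => thetaPnone L M
  | (M, some e) => thetaPsome L κM M e

/-- The projective coordinates `(1 : e^{y'_1} : ⋯ : e^{y'_β})` of the torus factor
`𝔾ₘ^β ⊂ ℙ^β`. [folklore] -/
def thetaT : Option β → (β ⊕ (γ ⊕ δ) → ℂ) → ℂ
  | none => fun _ => 1
  | some j => fun w => cexp (w (iy j))

/-- **The theta functions of `M_κ = 𝔾ₘ^β × P_κ`** (Segre product of the two factors): entire
functions on `Lie M_κ,ℂ` giving the projective coordinates of `exp_{M_κ}(w)`. [folklore] -/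
def theta (J : Option β × ThetaIdx γ δ) (w : β ⊕ (γ ⊕ δ) → ℂ) : ℂ :=
  thetaT J.1 w * thetaP L κM J.2 w

omit [Fintype β] [Fintype δ] in
/-- `Θ^P_{(M, none)}`. [folklore] -/
@[simp] theorem thetaP_none (M : γ → Fin 3) :
    thetaP L κM (M, none) = thetaPnone (β := β) (δ := δ) L M := rfl

omit [Fintype β] [Fintype δ] in
/-- `Θ^P_{(M, some e)}`. [folklore] -/
@[simp] theorem thetaP_some (M : γ → Fin 3) (e : δ) :
    thetaP L κM (M, some e) = thetaPsome (β := β) L κM M e := rfl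

omit [Fintype β] [Fintype γ] [Fintype δ] [DecidableEq γ] in
/-- `thetaT none = 1`. [folklore] -/
@[simp] theorem thetaT_none (w : β ⊕ (γ ⊕ δ) → ℂ) : thetaT (β := β) (γ := γ) (δ := δ) none w = 1 :=
  rfl

omit [Fintype β] [Fintype γ] [Fintype δ] [DecidableEq γ] in
/-- `thetaT (some j) = e^{y'_j}`. [folklore] -/
@[simp] theorem thetaT_some (j : β) (w : β ⊕ (γ ⊕ δ) → ℂ) :
    thetaT (γ := γ) (δ := δ) (some j) w = cexp (w (iy j)) := rfl

/-! ### Holomorphy -/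

omit [DecidableEq γ] in
/-- `w ↦ P_i(z'_b(w))` is entire on `Lie M_κ,ℂ`. [folklore] -/
theorem differentiable_univExtP_comp (i : Fin 3) (b : γ) :
    Differentiable ℂ fun w : β ⊕ (γ ⊕ δ) → ℂ => L.univExtP i (w (iz b)) :=
  (L.differentiable_univExtP i).comp (differentiable_apply (𝕜 := ℂ) (iz b))

omit [DecidableEq γ] in
/-- `w ↦ Z_i(z'_b(w))` is entire on `Lie M_κ,ℂ`. [folklore] -/
theorem differentiable_univExtZ_comp (i : Fin 3) (b : γ) :
    Differentiable ℂ fun w : β ⊕ (γ ⊕ δ) → ℂ => L.univExtZ i (w (iz b)) :=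
  (L.differentiable_univExtZ i).comp (differentiable_apply (𝕜 := ℂ) (iz b))

omit [Fintype β] [Fintype γ] [Fintype δ] [DecidableEq γ] in
/-- Finite products of differentiable functions (into `ℂ`) are differentiable. [folklore] -/
theorem differentiable_finset_prod {ι E : Type*} [NormedAddCommGroup E] [NormedSpace ℂ E]
    [DecidableEq ι] (u : Finset ι) {g : ι → E → ℂ} (hg : ∀ i ∈ u, Differentiable ℂ (g i)) :
    Differentiable ℂ fun x => ∏ i ∈ u, g i x :=
  fun x => (HasFDerivAt.finsetProd fun i hi => (hg i hi x).hasFDerivAt).differentiableAt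

/-- `Θ^P_{(M, none)}` is entire. [folklore] -/
theorem differentiable_thetaPnone (M : γ → Fin 3) :
    Differentiable ℂ (thetaPnone (β := β) (δ := δ) L M) := by
  unfold thetaPnone
  exact differentiable_finset_prod Finset.univ fun b _ => differentiable_univExtP_comp L (M b) b

/-- `Θ^P_{(M, some e)}` is entire. [folklore] -/
theorem differentiable_thetaPsome (M : γ → Fin 3) (e : δ) :
    Differentiable ℂ (thetaPsome (β := β) L κM M e) := by
  unfold thetaPsome
  refine ((differentiable_apply (𝕜 := ℂ) (is e)).mul (differentiable_thetaPnone L M)).sub ?_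
  refine Differentiable.fun_sum fun b _ => (differentiable_const _).mul ?_
  exact (differentiable_univExtZ_comp L (M b) b).mul
    (differentiable_finset_prod _ fun b' _ => differentiable_univExtP_comp L (M b') b')

/-- The theta functions of `P_κ` are entire. [folklore] -/
theorem differentiable_thetaP (I : ThetaIdx γ δ) : Differentiable ℂ (thetaP (β := β) L κM I) := by
  obtain ⟨M, _ | e⟩ := I
  · exact differentiable_thetaPnone L M
  · exact differentiable_thetaPsome L κM M e

omit [DecidableEq γ] in
/-- The torus coordinates are entire. [folklore] -/
theorem differentiable_thetaT (a : Option β) : Differentiable ℂ (thetaT (γ := γ) (δ := δ) a) := by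
  rcases a with _ | j
  · exact differentiable_const _
  · exact (differentiable_apply (𝕜 := ℂ) (iy j)).cexp

/-- **The theta functions of `M_κ` are entire.** [folklore] -/
theorem differentiable_theta (J : Option β × ThetaIdx γ δ) : Differentiable ℂ (theta L κM J) :=
  (differentiable_thetaT J.1).mul (differentiable_thetaP L κM J.2)

/-! ### Values off the divisors -/

omit [Fintype β] [Fintype δ] [DecidableEq γ] in
/-- Off the divisors `z'_b ∈ Λ`: `Θ^P_{(M, none)}(w) = ∏_b σ(z'_b)³ · ∏_b A_{M b}(z'_b)` with
`A = (1, ℘, ℘′)`. [folklore] -/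
theorem thetaPnone_eq (M : γ → Fin 3) {w : β ⊕ (γ ⊕ δ) → ℂ} (hw : ∀ b, w (iz b) ∉ L.lattice) :
    thetaPnone (δ := δ) L M w = (∏ b, L.weierstrassSigma (w (iz b)) ^ 3) *
      ∏ b, ![1, ℘[L] (w (iz b)), ℘'[L] (w (iz b))] (M b) := by
  unfold thetaPnone
  rw [← Finset.prod_mul_distrib]
  refine Finset.prod_congr rfl fun b _ => ?_
  obtain ⟨p0, p1, p2⟩ := PeriodPair.univExtP_eq (hw b)
  have : ∀ i : Fin 3, L.univExtP i (w (iz b)) =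
      L.weierstrassSigma (w (iz b)) ^ 3 * ![1, ℘[L] (w (iz b)), ℘'[L] (w (iz b))] i := by
    intro i; fin_cases i
    · simpa using p0
    · simpa using p1
    · simpa using p2
  exact this (M b)

omit [Fintype β] [Fintype δ] in
/-- Off the divisors: `Θ^P_{(M, some e)}(w) = ∏_b σ(z'_b)³ · (∏_b A_{M b}(z'_b)) · ν_e(w) + (the
correction) `∑_{b : M b = 2} 2κ_{eb} ℘(z'_b)² ∏_{b' ≠ b} A_{M b'}`, in the compact form
`∏σ³ · (ν_e ∏_b A_{M b} - ∑_b κ_{eb} B_{M b}(z'_b) ∏_{b'≠b} A_{M b'})` with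
`B = (0, 0, 2℘²)` absorbed as `A_i ζ - (Z_i/σ³) = -B_i`: here stated through the companions,
`Θ^P_{(M,some e)} = s_e Θ^P_{(M,none)} - ∑_b κ_{eb} Z_{Mb} ∏_{b'≠b} P_{Mb'}` with
`Z = σ³(ζ, ℘ζ, ℘′ζ + 2℘²)`. [folklore] -/
theorem thetaPsome_eq (M : γ → Fin 3) (e : δ) {w : β ⊕ (γ ⊕ δ) → ℂ}
    (hw : ∀ b, w (iz b) ∉ L.lattice) :
    thetaPsome L κM M e w = (∏ b, L.weierstrassSigma (w (iz b)) ^ 3) *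
      (w (is e) * ∏ b, ![1, ℘[L] (w (iz b)), ℘'[L] (w (iz b))] (M b) -
        ∑ b, (κM e b : ℂ) *
          (![L.weierstrassZeta (w (iz b)), ℘[L] (w (iz b)) * L.weierstrassZeta (w (iz b)),
              ℘'[L] (w (iz b)) * L.weierstrassZeta (w (iz b)) + 2 * ℘[L] (w (iz b)) ^ 2] (M b) *
            ∏ b' ∈ Finset.univ.erase b, ![1, ℘[L] (w (iz b')), ℘'[L] (w (iz b'))] (M b'))) := by
  have hA : ∀ b (i : Fin 3), L.univExtP i (w (iz b)) =
      L.weierstrassSigma (w (iz b)) ^ 3 * ![1, ℘[L] (w (iz b)), ℘'[L] (w (iz b))] i := by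
    intro b i
    obtain ⟨p0, p1, p2⟩ := PeriodPair.univExtP_eq (hw b)
    fin_cases i
    · simpa using p0
    · simpa using p1
    · simpa using p2
  have hB : ∀ b (i : Fin 3), L.univExtZ i (w (iz b)) =
      L.weierstrassSigma (w (iz b)) ^ 3 *
        ![L.weierstrassZeta (w (iz b)), ℘[L] (w (iz b)) * L.weierstrassZeta (w (iz b)),
          ℘'[L] (w (iz b)) * L.weierstrassZeta (w (iz b)) + 2 * ℘[L] (w (iz b)) ^ 2] i := by
    intro b i
    obtain ⟨z0, z1, z2⟩ := PeriodPair.univExtZ_eq (hw b)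
    fin_cases i
    · simpa using z0
    · simpa using z1
    · simpa using z2
  unfold thetaPsome
  rw [thetaPnone_eq L M hw, mul_sub, Finset.mul_sum]
  congr 1
  · ring
  · refine Finset.sum_congr rfl fun b _ => ?_
    rw [hB b (M b)]
    have hprod : ∏ b' ∈ Finset.univ.erase b, L.univExtP (M b') (w (iz b')) =
        (∏ b' ∈ Finset.univ.erase b, L.weierstrassSigma (w (iz b')) ^ 3) *
          ∏ b' ∈ Finset.univ.erase b, ![1, ℘[L] (w (iz b')), ℘'[L] (w (iz b'))] (M b') := by
      rw [← Finset.prod_mul_distrib]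
      exact Finset.prod_congr rfl fun b' _ => hA b' (M b')
    rw [hprod, ← Finset.mul_prod_erase Finset.univ (fun b' => L.weierstrassSigma (w (iz b')) ^ 3)
      (Finset.mem_univ b)]
    ring

/-! ### Automorphy under the kernel of `exp_{M_κ}` -/

omit [Fintype β] [Fintype δ] in
/-- **Automorphy under `ker(exp_{M_κ})`.** For `k ∈ GaGmE.Std.ker L κM`
(`y'_j ∈ 2πiℤ`, `z'_b = m_bω₁ + n_bω₂`, `s_e = ∑_b κ_{eb}(m_bη₁ + n_bη₂)`) and every `w` there is
`c ≠ 0` with `Θ_J(w + k) = c · Θ_J(w)` for ALL `J`: the torus coordinates are `2πi`-periodic, each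
`E`-block picks up the factor `c_b` of `UnivExtThetaPoints.lean`, and the shifts `η(λ_b) P` of the
`ζ`-companions cancel exactly against the `s`-shift of the kernel vector. Hence `w ↦ [Θ(w)]` is a
well-defined map on `M_κ(ℂ) = Lie M_κ,ℂ / ker`. [folklore] -/
theorem exists_theta_add_ker (w : β ⊕ (γ ⊕ δ) → ℂ) {k : β ⊕ (γ ⊕ δ) → ℂ} (hk : k ∈ ker L κM) :
    ∃ c : ℂ, c ≠ 0 ∧ ∀ J, theta L κM J (w + k) = c * theta L κM J w := by
  obtain ⟨hy, m, n, hz, hs⟩ := hk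
  -- blockwise factors
  have hb : ∀ b, ∃ c : ℂ, c ≠ 0 ∧
      (∀ i, L.univExtP i (w (iz b) + k (iz b)) = c * L.univExtP i (w (iz b))) ∧
      (∀ i, L.univExtZ i (w (iz b) + k (iz b)) =
        c * (L.univExtZ i (w (iz b)) + (m b * L.η₁ + n b * L.η₂) * L.univExtP i (w (iz b)))) := by
    intro b
    obtain ⟨c, hc, h⟩ := L.exists_univExtTheta_add_lattice (m b) (n b) (w (iz b)) 0
    refine ⟨c, hc, fun i => ?_, fun i => ?_⟩
    · have := h (Sum.inl i)
      simpa [hz b] using this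
    · have hP := h (Sum.inl i)
      have hZ := h (Sum.inr i)
      simp only [PeriodPair.univExtTheta_inl, PeriodPair.univExtTheta_inr, zero_add, zero_mul,
        zero_sub, mul_neg] at hP hZ
      rw [hz b]
      linear_combination -hZ + (m b * L.η₁ + n b * L.η₂) * hP
  choose c hc hP hZ using hb
  refine ⟨∏ b, c b, Finset.prod_ne_zero_iff.mpr fun b _ => hc b, ?_⟩
  -- the torus coordinates are invariant
  have hT : ∀ a, thetaT (γ := γ) (δ := δ) a (w + k) = thetaT a w := by
    rintro (_ | j)
    · rfl
    · obtain ⟨p, hp⟩ := hy j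
      simp only [thetaT_some, Pi.add_apply, hp, Complex.exp_add, Complex.exp_int_mul_two_pi_mul_I,
        mul_one]
  -- the uncorrected products
  have hnone : ∀ M : γ → Fin 3, thetaPnone (β := β) (δ := δ) L M (w + k) =
      (∏ b, c b) * thetaPnone L M w := by
    intro M
    unfold thetaPnone
    rw [← Finset.prod_mul_distrib]
    exact Finset.prod_congr rfl fun b _ => hP b (M b)
  -- the fibre sections
  have hsome : ∀ (M : γ → Fin 3) (e : δ), thetaPsome (β := β) L κM M e (w + k) =
      (∏ b, c b) * thetaPsome L κM M e w := by
    intro M e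
    have herase : ∀ b, ∏ b' ∈ Finset.univ.erase b, L.univExtP (M b') ((w + k) (iz b')) =
        (∏ b' ∈ Finset.univ.erase b, c b') *
          ∏ b' ∈ Finset.univ.erase b, L.univExtP (M b') (w (iz b')) := fun b => by
      rw [← Finset.prod_mul_distrib]
      exact Finset.prod_congr rfl fun b' _ => hP b' (M b')
    have hce : ∀ b, c b * ∏ b' ∈ Finset.univ.erase b, c b' = ∏ b', c b' := fun b =>
      Finset.mul_prod_erase Finset.univ c (Finset.mem_univ b)
    have hPe : ∀ b, L.univExtP (M b) (w (iz b)) *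
        ∏ b' ∈ Finset.univ.erase b, L.univExtP (M b') (w (iz b')) = thetaPnone (β := β) (δ := δ) L M w :=
      fun b => Finset.mul_prod_erase Finset.univ (fun b' => L.univExtP (M b') (w (iz b')))
        (Finset.mem_univ b)
    unfold thetaPsome
    rw [hnone M]
    simp only [Pi.add_apply] at herase ⊢
    simp only [herase, hZ, hs e]
    -- expand and regroup
    have key : ∀ b, (κM e b : ℂ) * (c b * (L.univExtZ (M b) (w (iz b)) +
        (m b * L.η₁ + n b * L.η₂) * L.univExtP (M b) (w (iz b))) *
        ((∏ b' ∈ Finset.univ.erase b, c b') *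
          ∏ b' ∈ Finset.univ.erase b, L.univExtP (M b') (w (iz b')))) =
        (∏ b', c b') * ((κM e b : ℂ) * (L.univExtZ (M b) (w (iz b)) *
          ∏ b' ∈ Finset.univ.erase b, L.univExtP (M b') (w (iz b')))) +
        (∏ b', c b') * ((κM e b : ℂ) * (m b * L.η₁ + n b * L.η₂)) * thetaPnone L M w := by
      intro b
      rw [← hce b, ← hPe b]
      ring
    rw [Finset.sum_congr rfl fun b _ => key b, Finset.sum_add_distrib, ← Finset.mul_sum,
      ← Finset.sum_mul, ← Finset.mul_sum]
    unfold thetaPnone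
    ring
  intro J
  obtain ⟨a, M, _ | e⟩ := J
  · simp only [theta, thetaP_none, hT, hnone]; ring
  · simp only [theta, thetaP_some, hT, hsome]; ring

/-! ### No common zeros -/

omit [Fintype β] [Fintype δ] in
/-- **The theta functions of `M_κ` have no common zero**: at `w`, take `a = none` and the block
index `M b = 0` where `z'_b ∉ Λ` (`P₀ = σ³ ≠ 0`) and `M b = 2` where `z'_b ∈ Λ` (`P₂ = -2c ≠ 0`).
[folklore] -/
theorem exists_theta_ne_zero (w : β ⊕ (γ ⊕ δ) → ℂ) : ∃ J, theta L κM J w ≠ 0 := by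
  classical
  let M : γ → Fin 3 := fun b => if w (iz b) ∈ L.lattice then 2 else 0
  have hM : ∀ b, L.univExtP (M b) (w (iz b)) ≠ 0 := by
    intro b
    by_cases hb : w (iz b) ∈ L.lattice
    · obtain ⟨m', n', hmn⟩ := PeriodPair.mem_lattice.mp hb
      obtain ⟨c, hc, -, -, h2, -⟩ := L.exists_univExtTheta_lattice m' n' 0
      simp only [PeriodPair.univExtTheta_inl] at h2
      have : M b = 2 := if_pos hb
      rw [this, ← hmn, h2]
      exact mul_ne_zero hc (by norm_num)
    · have : M b = 0 := if_neg hb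
      rw [this, (PeriodPair.univExtP_eq hb).1]
      exact pow_ne_zero _ (L.weierstrassSigma_ne_zero hb)
  refine ⟨(none, (M, none)), ?_⟩
  simp only [theta, thetaT_none, thetaP_none, one_mul, thetaPnone]
  exact Finset.prod_ne_zero_iff.mpr fun b _ => hM b

end Std

end GaGmE

end Literature.NumberTheory.Transcendental

end
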